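import Literature.NumberTheory.Automorphic.SiegelReducedFamiliesCutoff
import Literature.NumberTheory.Automorphic.ResGLnHermitianConeOpen
import Mathlib.Topology.Algebra.Module.FiniteDimension
import HarnessLib

/-!
# A smooth Siegel cut-off on the positive cone (stub `stub_siegelCutoff` of line `Sketch`)

Crux `HeckeEigenvalueField` (stmt-Langlands-13632), line `Sketch`, stub POU-A.  Borel's
injectivity statement (c') for `Res_{K/ℚ} GL_n` is proved by self-regularisation on the cone
`X = ResGLnCone.posCone n K` of positive hermitian matrices over `K_∞ = mixedSpace K`; the
primitive is glued with a `Γ`-partition of unity `χ / ∑_γ χ ∘ γ⁻¹` built from a smooth CUT-OFF `χ`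
of a reduced set `{H | SiegelFamily.IsReduced c C τ n (placeFamily K H)}` (the image of a Siegel set
in the cone, [Borel1969, §12–§13]) whose first two derivatives are bounded polynomially in the
entries of `H` and `H⁻¹`.  This file proves the registered stub `stub_siegelCutoff`.

The cut-off itself is `Literature.NumberTheory.Automorphic.SiegelFamily.exists_tame_cutoff`
(`SiegelReducedFamiliesCutoff.lean`: product of smooth steps of the finitely many reduction
inequalities, recursively in the Schur complement, with *tame* bounds — derivatives of order `≤ 2`
bounded by `C · B^k` for a weight `B`, `Literature/Analysis/Calculus/WeightedTameFunctions.lean`),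
applied on the open cone (`ResGLnCone.isOpen_posCone`) to the family of places
`G H = placeFamily K H` with the weight `B H = 1 + ∑ (‖H_ij‖ + ‖(H⁻¹)_ij‖)`: the entries of `G` are
continuous linear in `H` (hence tame, the weight dominating the sup norm), `G H` is positive
definite at every place on the cone (a real positive definite matrix being complex positive
definite), and `(G H)⁻¹ = placeFamily K H⁻¹` (the determinant is a unit of `K_∞` on the cone and
inversion commutes with the evaluations at the places) has entries bounded by `B H`.

## References

* A. Borel, *Introduction aux groupes arithmétiques*, Hermann (1969), §12–§13 [Borel1969].
* A. Borel, *Regularization theorems in Lie algebra cohomology. Applications*, Duke Math. J. 50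
  (1983), §3.5 [Borel1983Regularization].
-/

set_option linter.dupNamespace false -- project-wide: `Summit.Langlands.Langlands` is the mandated namespace

noncomputable section

open scoped ComplexOrder Matrix Matrix.Norms.Elementwise ContDiff Topology Classical
open NumberField NumberField.mixedEmbedding Literature.NumberTheory.Automorphic
open Literature.Analysis.Calculus Set

namespace Summit.Langlands.Langlands.Theorems.HeckeEigenvalueField.Res

/-! ### The positive cone of `Res_{K/ℚ} GL_n`: entries, inverses and the weight -/

section Cone

variable {n : ℕ} {K : Type} [Field K]

/-- On the positive cone the determinant is a unit of `K_∞` (non-zero at every place). [folklore] -/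
theorem cutoff_isUnit_det {H : ResGLnCone.hermSpace n K} (hH : H ∈ ResGLnCone.posCone n K) :
    IsUnit (H : Matrix (Fin n) (Fin n) (mixedSpace K)).det := by
  rw [Prod.isUnit_iff, Pi.isUnit_iff, Pi.isUnit_iff]
  refine ⟨fun w => ?_, fun w => ?_⟩
  · rw [isUnit_iff_ne_zero]
    have h := (hH.1 w).det_pos
    rw [← RingHom.mapMatrix_apply, ← RingHom.map_det] at h
    exact h.ne'
  · rw [isUnit_iff_ne_zero]
    have h := (hH.2 w).det_pos
    rw [← RingHom.mapMatrix_apply, ← RingHom.map_det] at h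
    exact h.ne'

/-- The family of places of the inverse is the inverse of the family of places (on matrices of
unit determinant). [folklore] -/
theorem cutoff_placeFamily_inv {M : Matrix (Fin n) (Fin n) (mixedSpace K)} (hM : IsUnit M.det)
    (w : InfinitePlace K) :
    (SiegelFamily.placeFamily K M w)⁻¹ = SiegelFamily.placeFamily K M⁻¹ w := by
  by_cases hw : w.IsReal
  · rw [SiegelFamily.placeFamily_apply_of_isReal _ hw,
      SiegelFamily.placeFamily_apply_of_isReal _ hw]
    exact (map_nonsing_inv_of_isUnit_det
      (Complex.ofRealHom.comp (mixedSpaceEvalReal K ⟨w, hw⟩)) hM).symm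
  · have hwc : w.IsComplex := NumberField.InfinitePlace.not_isReal_iff_isComplex.mp hw
    rw [SiegelFamily.placeFamily_apply_of_isComplex _ hwc,
      SiegelFamily.placeFamily_apply_of_isComplex _ hwc]
    exact (map_nonsing_inv_of_isUnit_det (mixedSpaceEvalComplex K ⟨w, hwc⟩) hM).symm

/-- The entries of the family of places are bounded by the entries over `K_∞` (sup norm).
[folklore] -/
theorem cutoff_norm_placeFamily_le [NumberField K] (M : Matrix (Fin n) (Fin n) (mixedSpace K))
    (w : InfinitePlace K) (i j : Fin n) : ‖SiegelFamily.placeFamily K M w i j‖ ≤ ‖M i j‖ := by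
  by_cases hw : w.IsReal
  · rw [SiegelFamily.placeFamily_apply_of_isReal _ hw, Matrix.map_apply, Complex.norm_real]
    exact (norm_le_pi_norm (M i j).1 ⟨w, hw⟩).trans (norm_fst_le (M i j))
  · have hwc : w.IsComplex := NumberField.InfinitePlace.not_isReal_iff_isComplex.mp hw
    rw [SiegelFamily.placeFamily_apply_of_isComplex _ hwc, Matrix.map_apply]
    exact (norm_le_pi_norm (M i j).2 ⟨w, hwc⟩).trans (norm_snd_le (M i j))

/-- On the positive cone the family of places consists of positive definite complex matrices (a
real positive definite matrix being complex positive definite). [folklore] -/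
theorem cutoff_placeFamily_posDef {H : ResGLnCone.hermSpace n K} (hH : H ∈ ResGLnCone.posCone n K)
    (w : InfinitePlace K) :
    (SiegelFamily.placeFamily K (H : Matrix (Fin n) (Fin n) (mixedSpace K)) w).PosDef := by
  by_cases hw : w.IsReal
  · rw [SiegelFamily.placeFamily_apply_of_isReal _ hw]
    have h := posDef_map_ofReal (hH.1 ⟨w, hw⟩)
    rw [Matrix.map_map] at h
    exact h
  · have hwc : w.IsComplex := NumberField.InfinitePlace.not_isReal_iff_isComplex.mp hw
    rw [SiegelFamily.placeFamily_apply_of_isComplex _ hwc]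
    exact hH.2 ⟨w, hwc⟩

end Cone

/-! ### The registered stub -/

/-- **Stub POU-A — a smooth Siegel cut-off on the cone with polynomial `C²` bounds.**  Between two
families of reduction constants there is a smooth `χ : 0 ≤ χ ≤ 1` on the positive cone, `= 1` on the
`(c, C, τ)`-reduced matrices and vanishing off the `(c', C', τ')`-reduced ones, whose first two
derivatives grow at most polynomially in the entries of `H` and `H⁻¹`: the reduction conditions
(`SiegelFamily.IsReduced`, recursive in the Schur complement) are finitely many strict inequalities
`f < κ g` between polynomials in the entries with `g` a pivot (positive on the cone, `≥ 1 / poly(H⁻¹)`), and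
`χ = ∏ θ_{κ,κ'}(f / g)` for smooth steps `θ`. [cite: Borel1969, §12–§13] [cite: Borel1983Regularization, §3.5] -/
theorem stub_siegelCutoff (n : ℕ) (K : Type) [Field K] [NumberField K]
    {c C τ c' C' τ' : ℝ} (hc : 0 < c) (hC : 1 < C) (hτ : 0 < τ)
    (hcc' : c < c') (hCC' : C < C') (hττ' : τ < τ') :
    ∃ χ : ResGLnCone.hermSpace n K → ℝ,
      ContDiffOn ℝ ((⊤ : ℕ∞) : WithTop ℕ∞) χ (ResGLnCone.posCone n K) ∧
      (∀ H ∈ ResGLnCone.posCone n K, 0 ≤ χ H ∧ χ H ≤ 1) ∧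
      (∀ H ∈ ResGLnCone.posCone n K, SiegelFamily.IsReduced c C τ n
        (SiegelFamily.placeFamily K (H : Matrix (Fin n) (Fin n) (mixedSpace K))) → χ H = 1) ∧
      (∀ H ∈ ResGLnCone.posCone n K, χ H ≠ 0 → SiegelFamily.IsReduced c' C' τ' n
        (SiegelFamily.placeFamily K (H : Matrix (Fin n) (Fin n) (mixedSpace K)))) ∧
      ∃ (Cχ : ℝ) (k : ℕ), ∀ H ∈ ResGLnCone.posCone n K, ∀ v w : ResGLnCone.hermSpace n K,
        ‖fderiv ℝ χ H v‖ ≤ Cχ * (1 + ∑ i, ∑ j,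
            (‖(H : Matrix (Fin n) (Fin n) (mixedSpace K)) i j‖ +
              ‖(H : Matrix (Fin n) (Fin n) (mixedSpace K))⁻¹ i j‖)) ^ k * ‖v‖ ∧
        ‖iteratedFDeriv ℝ 2 χ H ![v, w]‖ ≤ Cχ * (1 + ∑ i, ∑ j,
            (‖(H : Matrix (Fin n) (Fin n) (mixedSpace K)) i j‖ +
              ‖(H : Matrix (Fin n) (Fin n) (mixedSpace K))⁻¹ i j‖)) ^ k * ‖v‖ * ‖w‖ := by
  have _keepC := hC
  have _keepτ := hτ
  -- the open set and the weight
  have hU : IsOpen (ResGLnCone.posCone n K) := ResGLnCone.isOpen_posCone n K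
  set B : ResGLnCone.hermSpace n K → ℝ := fun H => 1 + ∑ i, ∑ j,
    (‖(H : Matrix (Fin n) (Fin n) (mixedSpace K)) i j‖ +
      ‖(H : Matrix (Fin n) (Fin n) (mixedSpace K))⁻¹ i j‖) with hB_def
  have hentry : ∀ (H : ResGLnCone.hermSpace n K) (i j : Fin n),
      ‖(H : Matrix (Fin n) (Fin n) (mixedSpace K)) i j‖ +
        ‖(H : Matrix (Fin n) (Fin n) (mixedSpace K))⁻¹ i j‖ ≤ B H - 1 := by
    intro H i j
    simp only [hB_def, add_sub_cancel_left]
    refine le_trans ?_ (Finset.single_le_sum (f := fun i => ∑ j,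
      (‖(H : Matrix (Fin n) (Fin n) (mixedSpace K)) i j‖ +
        ‖(H : Matrix (Fin n) (Fin n) (mixedSpace K))⁻¹ i j‖))
      (fun i _ => Finset.sum_nonneg fun j _ => by positivity) (Finset.mem_univ i))
    exact Finset.single_le_sum (f := fun j =>
      (‖(H : Matrix (Fin n) (Fin n) (mixedSpace K)) i j‖ +
        ‖(H : Matrix (Fin n) (Fin n) (mixedSpace K))⁻¹ i j‖)) (fun j _ => by positivity)
      (Finset.mem_univ j)
  have hB1 : ∀ H : ResGLnCone.hermSpace n K, 1 ≤ B H := fun H => by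
    simp only [hB_def, le_add_iff_nonneg_right]
    exact Finset.sum_nonneg fun i _ => Finset.sum_nonneg fun j _ => by positivity
  have hB : ∀ H ∈ ResGLnCone.posCone n K, 1 ≤ B H := fun H _ => hB1 H
  have hBn : ∀ H ∈ ResGLnCone.posCone n K, ‖H‖ ≤ B H := by
    intro H _
    change ‖(H : Matrix (Fin n) (Fin n) (mixedSpace K))‖ ≤ B H
    refine (Matrix.norm_le_iff (zero_le_one.trans (hB1 H))).mpr fun i j => ?_
    calc ‖(H : Matrix (Fin n) (Fin n) (mixedSpace K)) i j‖
        ≤ ‖(H : Matrix (Fin n) (Fin n) (mixedSpace K)) i j‖ +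
            ‖(H : Matrix (Fin n) (Fin n) (mixedSpace K))⁻¹ i j‖ :=
          le_add_of_nonneg_right (norm_nonneg _)
      _ ≤ B H - 1 := hentry H i j
      _ ≤ B H := by linarith
  -- (H1) the entries of the family of places are continuous linear, hence tame
  have hG₀ : ∀ (w : InfinitePlace K) (i j : Fin n),
      ContDiffOn ℝ ∞ (fun H : ResGLnCone.hermSpace n K =>
        SiegelFamily.placeFamily K (H : Matrix (Fin n) (Fin n) (mixedSpace K)) w i j)
        (ResGLnCone.posCone n K) ∧
      ∃ (C₀ : ℝ) (k : ℕ), ∀ H ∈ ResGLnCone.posCone n K, ∀ l ≤ 2,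
        ‖iteratedFDerivWithin ℝ l (fun H : ResGLnCone.hermSpace n K =>
          SiegelFamily.placeFamily K (H : Matrix (Fin n) (Fin n) (mixedSpace K)) w i j)
          (ResGLnCone.posCone n K) H‖ ≤ C₀ * B H ^ k := by
    intro w i j
    have hlin : IsLinearMap ℝ (fun H : ResGLnCone.hermSpace n K =>
        SiegelFamily.placeFamily K (H : Matrix (Fin n) (Fin n) (mixedSpace K)) w i j) :=
      { map_add := fun H H' => by simp [SiegelFamily.placeFamily_add]
        map_smul := fun r H => by simp [SiegelFamily.placeFamily_smul] }
    exact tame_clm hU hB hBn (LinearMap.toContinuousLinearMap (hlin.mk' _))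
  -- (H2) positive definite at every place
  have hpd₀ : ∀ H ∈ ResGLnCone.posCone n K, ∀ w : InfinitePlace K,
      (SiegelFamily.placeFamily K (H : Matrix (Fin n) (Fin n) (mixedSpace K)) w).PosDef :=
    fun H hH w => cutoff_placeFamily_posDef hH w
  -- (H3) the inverses have polynomially bounded entries
  have hinv₀ : ∃ (C₀ : ℝ) (k : ℕ), ∀ H ∈ ResGLnCone.posCone n K, ∀ (w : InfinitePlace K)
      (i j : Fin n),
      ‖(SiegelFamily.placeFamily K (H : Matrix (Fin n) (Fin n) (mixedSpace K)) w)⁻¹ i j‖ ≤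
        C₀ * B H ^ k := by
    refine ⟨1, 1, fun H hH w i j => ?_⟩
    rw [one_mul, pow_one, cutoff_placeFamily_inv (cutoff_isUnit_det hH)]
    calc ‖SiegelFamily.placeFamily K (H : Matrix (Fin n) (Fin n) (mixedSpace K))⁻¹ w i j‖
        ≤ ‖(H : Matrix (Fin n) (Fin n) (mixedSpace K))⁻¹ i j‖ :=
          cutoff_norm_placeFamily_le _ w i j
      _ ≤ ‖(H : Matrix (Fin n) (Fin n) (mixedSpace K)) i j‖ +
            ‖(H : Matrix (Fin n) (Fin n) (mixedSpace K))⁻¹ i j‖ :=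
          le_add_of_nonneg_left (norm_nonneg _)
      _ ≤ B H - 1 := hentry H i j
      _ ≤ B H := by linarith
  -- the recursive cut-off
  obtain ⟨Φ, hΦt, hΦ01, hΦ1, hΦ0⟩ := SiegelFamily.exists_tame_cutoff hU hB hc hcc' hCC' hττ' n
    (fun H : ResGLnCone.hermSpace n K =>
      SiegelFamily.placeFamily K (H : Matrix (Fin n) (Fin n) (mixedSpace K))) hG₀ hpd₀ hinv₀
  obtain ⟨hΦs, CΦ, k, hΦb⟩ := hΦt
  refine ⟨Φ, hΦs, hΦ01, hΦ1, hΦ0, CΦ, k, fun H hH v w => ?_⟩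
  exact tame_apply_bounds hU hH (fun i hi => hΦb H hH i hi) v w

end Summit.Langlands.Langlands.Theorems.HeckeEigenvalueField.Res
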